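import Literature.NumberTheory.DiophantineApproximation.RhinViolaBaseIntegrals
import HarnessLib

/-!
# The Rhin–Viola double integrals `I_z^{(0)}(h, j, k, l, m)` and their linear decompositions

Topic `Literature/NumberTheory/DiophantineApproximation`. DEFINITIONS (`integrand`, `I0`) with proved API;
no named facts. Source: G. Rhin, C. Viola, *The permutation group method for the dilogarithm*, Ann. Sc.
Norm. Super. Pisa Cl. Sci. (5) 4 (2005) 389–437, §2: for integers `h, j, k, l, m ≥ 0` and `z > 1`,

  `I_z^{(0)}(h,j,k,l,m) = z^{−l−m} ∫₀¹∫₀¹ x^j (1−x)^h y^k (1−y)^l dx dy / (x(1−y)+yz)^{j+k−m+1}`   (2.1)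

(the real member of the family `I_z^{(0)}, I_z^{(1)}, I_z^{(2)}`, `I_z = I_z^{(0)} − (log z) I_z^{(1)}`, whose
arithmetic is Theorem 2.1 of the paper — the result on which Viola–Zudilin's Lemma 2.1 rests, cf.
`ViolaZudilinIntegrals.lean`, `DilogLandenLinearIndependenceRates.lean`). This file fixes the vocabulary
and proves the two **linear decompositions** that drive the inductive proof of Theorem 2.1 (pp. 405–408):

* (2.29) (`k, m ≥ 1`, from `y = 1 − (1−y)`):
  `I(h,j,k,l,m) = z^{−1} I(h,j,k−1,l,m−1) − I(h,j,k−1,l+1,m−1)`;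
* (2.41) (`h, l ≥ 1`, from `(1−x)(1−y) = z − (z−1)(1−y) − (x(1−y)+yz)`):
  `I(h,j,k,l,m) = I(h−1,j,k,l−1,m) − (z−1) I(h−1,j,k,l,m) − I(h−1,j,k,l−1,m+1)`;

together with the integrability of the integrand on the square and the base value
`I_z^{(0)}(0,0,0,0,0) = log z · Li₁(1/z) + Li₂(1/z)` (Lemma 2.3, `RhinViolaBaseIntegrals.lean`).

Design note. The printed exponent `j+k−m+1` may be `≤ 0` (Lemma 2.2 of the paper); to cover every
parameter with natural-number powers the integrand is written `x^j(1−x)^h y^k(1−y)^l · D^m / D^{j+k+1}`,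
`D = x(1−y)+yz` (`ViolaZudilin.denom₁`), which IS the printed `x^j(1−x)^h y^k(1−y)^l / D^{j+k−m+1}` wherever
`D ≠ 0`, i.e. everywhere on the square except the corner `(0,0)` (a null set; `integrand_eq_div_pow`). The
contour members `I^{(1)}, I^{(2)}` (residues at `y = x/(x−z)`, `x = z`) are NOT defined here.

## References

* G. Rhin, C. Viola, Ann. Sc. Norm. Super. Pisa Cl. Sci. (5) 4 (2005) 389–437, (2.1), (2.29), (2.41),
  Lemma 2.3. [RhinViola2005]
-/

noncomputable section

namespace Literature.NumberTheory.DiophantineApproximation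

namespace RhinViola

open _root_.MeasureTheory _root_.Set
open DilogPade (polylogSeries)
open ViolaZudilin (unitSquare weight denom₁ mem_unitSquare fst_le_denom₁ snd_le_denom₁ continuous_denom₁
  measurableSet_unitSquare isCompact_unitSquare)

/-- The integrand of `I_z^{(0)}(h,j,k,l,m)` (Rhin–Viola (2.1)), written with natural-number powers as
`x^j (1−x)^h y^k (1−y)^l · D^m / D^{j+k+1}`, `D = x(1−y) + yz`; off the corner `(0,0)` this is the printed
`x^j (1−x)^h y^k (1−y)^l / D^{j+k−m+1}`. [cite: RhinViola2005, (2.1)] -/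
def integrand (z : ℝ) (h j k l m : ℕ) (p : ℝ × ℝ) : ℝ :=
  p.1 ^ j * (1 - p.1) ^ h * p.2 ^ k * (1 - p.2) ^ l * denom₁ z p ^ m / denom₁ z p ^ (j + k + 1)

/-- **`I_z^{(0)}(h, j, k, l, m) = z^{−l−m} ∫∫_{[0,1]²} x^j(1−x)^h y^k(1−y)^l dx dy/(x(1−y)+yz)^{j+k−m+1}`**
(Rhin–Viola (2.1); the prefactor is the integer power `z^{-(l+m)}`). [cite: RhinViola2005, (2.1)] -/
def I0 (z : ℝ) (h j k l m : ℕ) : ℝ :=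
  z ^ (-((l : ℤ) + m)) * ∫ p in unitSquare, integrand z h j k l m p

/-! ### Elementary properties of the integrand -/

/-- Off the zero set of `D = x(1−y)+yz` and when `m ≤ j+k+1`, the integrand is the printed quotient
`x^j(1−x)^h y^k(1−y)^l / D^{j+k+1−m}`. [cite: RhinViola2005, (2.1)] -/
theorem integrand_eq_div_pow {z : ℝ} {h j k l m : ℕ} (hm : m ≤ j + k + 1) {p : ℝ × ℝ}
    (hD : denom₁ z p ≠ 0) :
    integrand z h j k l m p =
      p.1 ^ j * (1 - p.1) ^ h * p.2 ^ k * (1 - p.2) ^ l / denom₁ z p ^ (j + k + 1 - m) := by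
  rw [integrand, pow_sub₀ _ hD hm]
  field_simp

/-- The integrand with all parameters `0` is the weight `1/(x(1−y)+yz)`. [folklore] -/
theorem integrand_zero (z : ℝ) (p : ℝ × ℝ) : integrand z 0 0 0 0 0 p = weight z p := by
  simp [integrand, weight]

/-- The integrand is measurable. [folklore] -/
theorem measurable_integrand (z : ℝ) (h j k l m : ℕ) : Measurable (integrand z h j k l m) := by
  have hc : Continuous fun p : ℝ × ℝ =>
      p.1 ^ j * (1 - p.1) ^ h * p.2 ^ k * (1 - p.2) ^ l * denom₁ z p ^ m :=
    (ViolaZudilin.continuous_numer ⟨h, j, k, l, m, 0⟩).mul ((continuous_denom₁ z).pow m)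
  exact hc.measurable.div ((continuous_denom₁ z).pow _).measurable

/-- The numerator bound `x^j (1−x)^h y^k (1−y)^l ≤ D^j D^k` on the square (`z ≥ 1`; `x, y ≤ D`).
[folklore] -/
theorem numer_le_denom₁_pow {z : ℝ} (hz : 1 ≤ z) (h j k l : ℕ) {p : ℝ × ℝ} (hp : p ∈ unitSquare) :
    p.1 ^ j * (1 - p.1) ^ h * p.2 ^ k * (1 - p.2) ^ l ≤ denom₁ z p ^ j * denom₁ z p ^ k := by
  obtain ⟨⟨hx0, hx1⟩, hy0, hy1⟩ := mem_unitSquare.1 hp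
  have hxD : p.1 ≤ denom₁ z p := fst_le_denom₁ hz hp
  have hyD : p.2 ≤ denom₁ z p := snd_le_denom₁ hz hp
  have hD0 : 0 ≤ denom₁ z p := hx0.trans hxD
  have h1 : p.1 ^ j ≤ denom₁ z p ^ j := pow_le_pow_left₀ hx0 hxD j
  have h2 : (1 - p.1) ^ h ≤ 1 := pow_le_one₀ (by linarith) (by linarith)
  have h3 : p.2 ^ k ≤ denom₁ z p ^ k := pow_le_pow_left₀ hy0 hyD k
  have h4 : (1 - p.2) ^ l ≤ 1 := pow_le_one₀ (by linarith) (by linarith)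
  have s1 : p.1 ^ j * (1 - p.1) ^ h ≤ denom₁ z p ^ j * 1 :=
    mul_le_mul h1 h2 (pow_nonneg (by linarith) _) (pow_nonneg hD0 _)
  have s2 : p.1 ^ j * (1 - p.1) ^ h * p.2 ^ k ≤ denom₁ z p ^ j * 1 * denom₁ z p ^ k :=
    mul_le_mul s1 h3 (pow_nonneg hy0 _) (by rw [mul_one]; exact pow_nonneg hD0 _)
  have s3 : p.1 ^ j * (1 - p.1) ^ h * p.2 ^ k * (1 - p.2) ^ l ≤ denom₁ z p ^ j * 1 * denom₁ z p ^ k * 1 :=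
    mul_le_mul s2 h4 (pow_nonneg (by linarith) _)
      (by rw [mul_one]; exact mul_nonneg (pow_nonneg hD0 _) (pow_nonneg hD0 _))
  simpa only [mul_one] using s3

/-- **Domination**: on the square off the axis `x = 0` (where `D > 0`), for `z ≥ 1`,
`|integrand| ≤ z^m (1 + 1/D)` (`m = 0`: `≤ 1/D`; `m ≥ 1`: `≤ D^{m−1} ≤ z^{m−1}`). [folklore] -/
theorem abs_integrand_le {z : ℝ} (hz : 1 ≤ z) (h j k l m : ℕ) {p : ℝ × ℝ} (hp : p ∈ unitSquare)
    (hx : 0 < p.1) : |integrand z h j k l m p| ≤ z ^ m * (1 + weight z p) := by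
  obtain ⟨⟨hx0, hx1⟩, hy0, hy1⟩ := mem_unitSquare.1 hp
  have hD : 0 < denom₁ z p := hx.trans_le (fst_le_denom₁ hz hp)
  have hDz : denom₁ z p ≤ z := by
    rw [denom₁]; nlinarith [mul_nonneg hy0 (show (0 : ℝ) ≤ z - 1 by linarith)]
  have hw : 0 ≤ weight z p := ViolaZudilin.weight_nonneg hz hp
  have hnum0 : 0 ≤ p.1 ^ j * (1 - p.1) ^ h * p.2 ^ k * (1 - p.2) ^ l := by
    apply_rules [mul_nonneg, pow_nonneg] <;> linarith
  have hnum := numer_le_denom₁_pow hz h j k l hp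
  rw [abs_of_nonneg (by unfold integrand; positivity)]
  unfold integrand
  rcases Nat.eq_zero_or_pos m with rfl | hm
  · -- `m = 0`: `≤ D^{j+k}/D^{j+k+1} = 1/D`
    rw [pow_zero, mul_one, pow_zero, one_mul]
    calc p.1 ^ j * (1 - p.1) ^ h * p.2 ^ k * (1 - p.2) ^ l / denom₁ z p ^ (j + k + 1)
        ≤ denom₁ z p ^ j * denom₁ z p ^ k / denom₁ z p ^ (j + k + 1) :=
          div_le_div_of_nonneg_right hnum (by positivity)
      _ = weight z p := by rw [weight, pow_succ, pow_add]; field_simp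
      _ ≤ 1 + weight z p := by linarith
  · -- `m ≥ 1`: `≤ D^{m-1} ≤ z^{m-1} ≤ z^m ≤ z^m (1 + w)`
    obtain ⟨m', rfl⟩ : ∃ m', m = m' + 1 := ⟨m - 1, by omega⟩
    calc p.1 ^ j * (1 - p.1) ^ h * p.2 ^ k * (1 - p.2) ^ l * denom₁ z p ^ (m' + 1) /
          denom₁ z p ^ (j + k + 1)
        ≤ denom₁ z p ^ j * denom₁ z p ^ k * denom₁ z p ^ (m' + 1) / denom₁ z p ^ (j + k + 1) :=
          div_le_div_of_nonneg_right (mul_le_mul_of_nonneg_right hnum (by positivity)) (by positivity)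
      _ = denom₁ z p ^ m' := by rw [pow_succ, pow_succ, pow_add]; field_simp
      _ ≤ z ^ m' := pow_le_pow_left₀ hD.le hDz _
      _ ≤ z ^ (m' + 1) := pow_le_pow_right₀ hz (Nat.le_succ _)
      _ ≤ z ^ (m' + 1) * (1 + weight z p) := le_mul_of_one_le_right (by positivity) (by linarith)

/-- **The integrand of `I_z^{(0)}(h,j,k,l,m)` is integrable on the square** for `z ≥ 1` (dominated off
the null axis `x = 0` by `z^m (1 + 1/(x(1−y)+yz))`, `ViolaZudilin.integrableOn_weight`). [folklore] -/
theorem integrableOn_integrand {z : ℝ} (hz : 1 ≤ z) (h j k l m : ℕ) :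
    IntegrableOn (integrand z h j k l m) unitSquare volume := by
  have hF : IntegrableOn (fun p : ℝ × ℝ => z ^ m * (1 + weight z p)) unitSquare volume := by
    refine Integrable.const_mul (Integrable.add ?_ (ViolaZudilin.integrableOn_weight hz)) _
    exact integrableOn_const (isCompact_unitSquare.measure_lt_top.ne)
  refine Integrable.mono' hF (measurable_integrand z h j k l m).aestronglyMeasurable ?_
  filter_upwards [ae_restrict_mem measurableSet_unitSquare,
    ae_restrict_of_ae (s := unitSquare) ViolaZudilin.ae_fst_ne_zero_and_snd_ne_zero] with p hp hne
  rw [Real.norm_eq_abs]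
  exact abs_integrand_le hz h j k l m hp (lt_of_le_of_ne (mem_unitSquare.1 hp).1.1 (Ne.symm hne.1))

/-! ### The base value (Lemma 2.3) in this vocabulary -/

/-- `I_z^{(0)}(0,0,0,0,0) = log z · Li₁(1/z) + Li₂(1/z)` for `z > 1` (Rhin–Viola (2.12)–(2.14)).
[cite: RhinViola2005, Lemma 2.3] -/
theorem I0_zero {z : ℝ} (hz : 1 < z) :
    I0 z 0 0 0 0 0 = Real.log z * polylogSeries 1 (1 / z) + polylogSeries 2 (1 / z) := by
  rw [I0, ← setIntegral_weight_unitSquare hz]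
  simp [integrand_zero]

/-! ### The linear decompositions (2.29) and (2.41) -/

/-- Pointwise form of (2.29) (`y = 1 − (1−y)`): for every point,
`integrand(h,j,k+1,l,m+1) = integrand(h,j,k,l,m) − integrand(h,j,k,l+1,m)` (one factor `D` cancels; at
`D = 0` all three vanish). [cite: RhinViola2005, (2.29)] -/
theorem integrand_succ_k_succ_m (z : ℝ) (h j k l m : ℕ) (p : ℝ × ℝ) :
    integrand z h j (k + 1) l (m + 1) p = integrand z h j k l m p - integrand z h j k (l + 1) m p := by
  unfold integrand
  by_cases hD : denom₁ z p = 0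
  · simp [hD]
  · field_simp
    ring

/-- Pointwise form of (2.41) (`(1−x)(1−y) = z − (z−1)(1−y) − (x(1−y)+yz)`): for every point,
`integrand(h+1,j,k,l+1,m) = z·integrand(h,j,k,l,m) − (z−1)·integrand(h,j,k,l+1,m) − integrand(h,j,k,l,m+1)`.
[cite: RhinViola2005, (2.41)] -/
theorem integrand_succ_h_succ_l (z : ℝ) (h j k l m : ℕ) (p : ℝ × ℝ) :
    integrand z (h + 1) j k (l + 1) m p = z * integrand z h j k l m p
      - (z - 1) * integrand z h j k (l + 1) m p - integrand z h j k l (m + 1) p := by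
  unfold integrand denom₁
  rw [mul_div_assoc', mul_div_assoc', ← sub_div, ← sub_div]
  congr 1
  ring

/-- **Rhin–Viola (2.29)**: for `z ≥ 1` (indices shifted so that `k, m ≥ 1` read `k+1, m+1`),
`I_z^{(0)}(h,j,k+1,l,m+1) = z^{−1} I_z^{(0)}(h,j,k,l,m) − I_z^{(0)}(h,j,k,l+1,m)` (linearity of the integral
and `z^{−(l+m+1)} = z^{−1} z^{−(l+m)} = z^{−((l+1)+m)}`). [cite: RhinViola2005, (2.29)] -/
theorem I0_succ_k_succ_m {z : ℝ} (hz : 1 ≤ z) (h j k l m : ℕ) :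
    I0 z h j (k + 1) l (m + 1) = z⁻¹ * I0 z h j k l m - I0 z h j k (l + 1) m := by
  have hz0 : z ≠ 0 := by positivity
  have hint : ∫ p in unitSquare, integrand z h j (k + 1) l (m + 1) p =
      (∫ p in unitSquare, integrand z h j k l m p) - ∫ p in unitSquare, integrand z h j k (l + 1) m p := by
    rw [← integral_sub (integrableOn_integrand hz h j k l m) (integrableOn_integrand hz h j k (l + 1) m)]
    exact setIntegral_congr_fun measurableSet_unitSquare fun p _ => integrand_succ_k_succ_m z h j k l m p
  have p1 : z ^ (-((l : ℤ) + ((m + 1 : ℕ) : ℤ))) = z⁻¹ * z ^ (-((l : ℤ) + m)) := by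
    rw [Nat.cast_succ, show -((l : ℤ) + ((m : ℤ) + 1)) = -((l : ℤ) + m) - 1 by ring, zpow_sub_one₀ hz0]
    ring
  have p2 : z ^ (-(((l + 1 : ℕ) : ℤ) + (m : ℤ))) = z⁻¹ * z ^ (-((l : ℤ) + m)) := by
    rw [Nat.cast_succ, show -(((l : ℤ) + 1) + m) = -((l : ℤ) + m) - 1 by ring, zpow_sub_one₀ hz0]
    ring
  simp only [I0]
  rw [hint, p1, p2]
  ring

/-- **Rhin–Viola (2.41)**: for `z ≥ 1` (indices shifted so that `h, l ≥ 1` read `h+1, l+1`),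
`I_z^{(0)}(h+1,j,k,l+1,m) = I_z^{(0)}(h,j,k,l,m) − (z−1) I_z^{(0)}(h,j,k,l+1,m) − I_z^{(0)}(h,j,k,l,m+1)`.
[cite: RhinViola2005, (2.41)] -/
theorem I0_succ_h_succ_l {z : ℝ} (hz : 1 ≤ z) (h j k l m : ℕ) :
    I0 z (h + 1) j k (l + 1) m =
      I0 z h j k l m - (z - 1) * I0 z h j k (l + 1) m - I0 z h j k l (m + 1) := by
  have hz0 : z ≠ 0 := by positivity
  have h1 := integrableOn_integrand hz h j k l m
  have h2 := integrableOn_integrand hz h j k (l + 1) m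
  have h3 := integrableOn_integrand hz h j k l (m + 1)
  have hint : ∫ p in unitSquare, integrand z (h + 1) j k (l + 1) m p =
      z * (∫ p in unitSquare, integrand z h j k l m p)
        - (z - 1) * (∫ p in unitSquare, integrand z h j k (l + 1) m p)
        - ∫ p in unitSquare, integrand z h j k l (m + 1) p := by
    calc ∫ p in unitSquare, integrand z (h + 1) j k (l + 1) m p
        = ∫ p in unitSquare, (z * integrand z h j k l m p - (z - 1) * integrand z h j k (l + 1) m p
            - integrand z h j k l (m + 1) p) :=
          setIntegral_congr_fun measurableSet_unitSquare fun p _ => integrand_succ_h_succ_l z h j k l m p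
      _ = (∫ p in unitSquare, (z * integrand z h j k l m p - (z - 1) * integrand z h j k (l + 1) m p))
            - ∫ p in unitSquare, integrand z h j k l (m + 1) p :=
          integral_sub ((h1.const_mul z).sub (h2.const_mul (z - 1))) h3
      _ = _ := by rw [integral_sub (h1.const_mul z) (h2.const_mul (z - 1)), integral_const_mul, integral_const_mul]
  have p1 : z ^ (-(((l + 1 : ℕ) : ℤ) + (m : ℤ))) = z⁻¹ * z ^ (-((l : ℤ) + m)) := by
    rw [Nat.cast_succ, show -(((l : ℤ) + 1) + m) = -((l : ℤ) + m) - 1 by ring, zpow_sub_one₀ hz0]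
    ring
  have p2 : z ^ (-((l : ℤ) + ((m + 1 : ℕ) : ℤ))) = z⁻¹ * z ^ (-((l : ℤ) + m)) := by
    rw [Nat.cast_succ, show -((l : ℤ) + ((m : ℤ) + 1)) = -((l : ℤ) + m) - 1 by ring, zpow_sub_one₀ hz0]
    ring
  simp only [I0]
  rw [hint, p1, p2]
  field_simp

end RhinViola

end Literature.NumberTheory.DiophantineApproximation

end
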